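import Summits.BirchSwinnertonDyer.BirchSwinnertonDyer.Theses.VerticalContact
import Summits.BirchSwinnertonDyer.BirchSwinnertonDyer.Theses.SelmerRank
import Literature.NumberTheory.EllipticCurves.KatoRankBound
import HarnessLib

/-!
# Line `Sketch` for crux `PGSelmerBSD` (stmt-BirchSwinnertonDyer-17810), route VerticalContact — lead's skeleton

Crux (fixed, by name): `VerticalContact.PGSelmerBSD` —
`∀ W elliptic, globally minimal, (¬ ∃ q, multiplicative at q) → ∃ p, corank_{ℤ_p} Sel_{p^∞}(W/ℚ) = r_an(W)`.

Line `Sketch` (crux ideas `lambda-minimal-free-prime` + `big-heegner-free-pair`, ideator 2), driven by the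
lead on its λ-MINIMAL branch (PICKED.md): the crux's unconditioned `∃ p` is spent on ONE admissible prime at
which the Mazur–Tate–Teitelbaum `p`-adic `L`-function has no excess zero at `T = 0`.

Composition `PGSelmerBSD_of` (sorry-free), cells:
* `r_an ≤ 1` (any curve): `stub_rankLeOne` — Gross–Zagier–Kolyvagin read on the Selmer side (bsd.S17,
  tree fact `rank_eq_analyticRank_of_analyticRank_le_one`, via the proved
  `selmerCorank_eq_analyticRank_of_analyticRank_le_one`), at any prime;
* CM, `r_an ≥ 2`: `stub_selmerRankCM` (= route SelmerRank's item `SelmerRankCM`, stmt-18086, verbatim) at a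
  good ordinary `p ≥ 5` from the proved supply `exists_good_ordinary_prime_holds`;
* non-CM, `r_an ≥ 2`: `stub_freeOrderMinimalPrime` (the transfer target C⁺: ONE admissible `p` with
  `ord_{T=0} L_p(E,T) ≤ r_an` for every newform of `E`) + `stub_modular` (a newform exists: modularity,
  tree fact `exists_isNewformOf`) + `stub_katoBound` (Kato 2004 Thm 18.4 at that `p`: `corank_p ≤ ord_T L_p`,
  tree fact `kato_selmerCorank_le_order_padicLFunction`) give `corank_p ≤ r_an`; `stub_selmerRankLB`
  (= this route's item `SelmerRankLB`, stmt-0131, verbatim) gives `r_an ≤ corank_p` at the same `p`.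

Hardest stub (lead): `stub_freeOrderMinimalPrime`. Stubs 2/3/1 are literature leaves (modularity, Kato 18.4,
GZK); stubs 5/6 are existing items served on their own seats.
Disproof used: none existed when the line was picked (2026-08-17T11:30Z); cdisprove cycle 1 (Disproof.lean,
12:42Z) = NO KILL, no `-- Targets` on these stubs; its note (ii) (typing trap `order = ⊤` for a zero series) does
not bite: `order ≤ ↑r_an` makes non-vanishing of `L_p` part of what stub 4 asserts (true: Rohrlich).

STATUS (lead, 2026-08-17T17:50Z). No stub is closed unconditionally; the line cannot close in the tree today.
Landed `--supports` files (Theorems/VerticalContactPGSelmerBSD*.lean): stub 1 ⇐ bsd.S17 by name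
(`stub_rankLeOne_of_facts`, p158632); stub 2 ⇐ `exists_isNewformOf` (`stub_modular_of_facts`, p158740); stub 3 ⇐
Kato 18.4 fact / `kato_divisibility` (`stub_katoBound_of_facts`, `…_of_kato_divisibility`, p158688) and ⇐ the
shared ITEM `LeadingTerm.KatoDivisibility` (stmt-18082) by name (`stub_katoBound_of_katoDivisibility`, p169801);
stubs 5, 6 = items 0131 / 18086 verbatim (`Iff.rfl` below); stub 4 (C⁺) = open mathematics from r_an = 2
(presearch: nothing in print gives one good prime in rank ≥ 1), λ-census `LAMBDA-CENSUS.md` (kit j025800):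
14/14 rank-2 sector curves with N ≤ 12000 certified, every non-CM one at p ∈ {5,7}. Transfer theorems landed:
`pgSelmerBSD_of_freeOrderMinimalPrime_of_facts` (p158906: GZK → modularity → Kato(∀) → C⁺ → 0131 → 18086 → crux) and
`pgSelmerBSD_of_freeOrderMinimalPrime_of_items` (p169934: same with KatoDivisibility (18082) by name) — the
`--glue-by` shape if C⁺ is promoted to an item; the sector-split glue `pgSelmerBSD_of_subs` (p158621:
UBPotentiallyGood (15878) → 0131 → 18086 → crux) is the alternative with no new statement.
-/

set_option linter.dupNamespace false

open scoped MatrixGroups ModularForm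

open CongruenceSubgroup Literature.NumberTheory.EllipticCurves.ModularForms

namespace Summit.BirchSwinnertonDyer.BirchSwinnertonDyer.Cruxes.PGSelmerBSD.Sketch

open Summit.BirchSwinnertonDyer.BirchSwinnertonDyer.Theses
open Literature.NumberTheory.EllipticCurves

/-- STUB 1 (Gross–Zagier–Kolyvagin slice, literature leaf bsd.S17): in analytic rank `≤ 1` the crux holds
at some (indeed every) prime. -/
theorem stub_rankLeOne :
    ∀ (W : WeierstrassCurve ℚ) [W.IsElliptic] [W.IsGloballyMinimal],
      W.analyticRank ≤ 1 → ∃ (p : ℕ) (_ : Fact p.Prime), W.selmerCorank p = W.analyticRank := by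
  sorry

/-- STUB 2 (modularity supply, literature leaf BCDT 2001 Thm A = tree fact `exists_isNewformOf`): every
elliptic curve over `ℚ` has a weight-2 newform. -/
theorem stub_modular :
    ∀ (W : WeierstrassCurve ℚ) [W.IsElliptic] [W.IsGloballyMinimal],
      ∃ (N : ℕ) (_ : NeZero N) (f : CuspForm (Gamma0 N) 2), IsNewformOf W f := by
  sorry

/-- STUB 3 (Kato 2004 Thm 18.4 at an admissible prime, literature leaf = tree fact
`kato_selmerCorank_le_order_padicLFunction` restricted to `p ≥ 5`, big image, `r_an ≥ 2`):
`corank_{ℤ_p} Sel_{p^∞}(E/ℚ) ≤ ord_{T=0} L_p(E,T)`. -/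
theorem stub_katoBound :
    ∀ (W : WeierstrassCurve ℚ) [W.IsElliptic] [W.IsGloballyMinimal] (p : ℕ) [Fact p.Prime],
      5 ≤ p → W.HasGoodReductionAtPrime p → ¬ (p : ℤ) ∣ W.frobeniusTrace p →
        W.HasSurjectiveModNGaloisRep p → 2 ≤ W.analyticRank →
        ∀ {N : ℕ} [NeZero N] (f : CuspForm (Gamma0 N) 2), IsNewformOf W f →
          (W.selmerCorank p : ℕ∞) ≤ (padicLFunction f (unitRoot W p : ℚ_[p])).order := by
  sorry

/-- STUB 4 (transfer target C⁺ = `FreeOrderMinimalPrime`, the line's bet; lead): for every NON-CM curve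
of the sector with `r_an ≥ 2` there is ONE admissible prime `p` (`p ≥ 5` good ordinary, `ρ̄_{E,p}`
surjective) at which the `p`-adic `L`-function of every newform of `E` has `ord_{T=0} ≤ r_an(E)`
("no excess `p`-adic zero at one prime"; λ-minimality certificate in the card). -/
theorem stub_freeOrderMinimalPrime :
    ∀ (W : WeierstrassCurve ℚ) [W.IsElliptic] [W.IsGloballyMinimal],
      (¬ ∃ (q : ℕ) (_ : Fact q.Prime), W.HasMultiplicativeReductionAtPrime q) → ¬ W.HasCM →
      2 ≤ W.analyticRank →
      ∃ (p : ℕ) (_ : Fact p.Prime), (5 ≤ p ∧ W.HasGoodReductionAtPrime p ∧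
        ¬ (p : ℤ) ∣ W.frobeniusTrace p ∧ W.HasSurjectiveModNGaloisRep p) ∧
        ∀ {N : ℕ} [NeZero N] (f : CuspForm (Gamma0 N) 2), IsNewformOf W f →
          (padicLFunction f (unitRoot W p : ℚ_[p])).order ≤ W.analyticRank := by
  sorry

/-- STUB 5 (= VerticalContact.SelmerRankLB = SelmerRank.SelmerRankLB, stmt-0131, verbatim): the lower bound
at every big-image good ordinary prime `p ≥ 5`. Theorem for `r_an ≤ 3`, open from `r_an = 4`. -/
theorem stub_selmerRankLB :
    ∀ (W : WeierstrassCurve ℚ) [W.IsElliptic] [W.IsGloballyMinimal] (p : ℕ) [Fact p.Prime],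
      5 ≤ p → W.HasGoodReductionAtPrime p → ¬ (p : ℤ) ∣ W.frobeniusTrace p →
        W.HasSurjectiveModNGaloisRep p → W.analyticRank ≤ W.selmerCorank p := by
  sorry

/-- STUB 6 (= SelmerRank.SelmerRankCM, stmt-18086, verbatim): Selmer-rank BSD for CM curves at every good
ordinary `p ≥ 5`. Open from `min(corank_p, r_an) ≥ 2`. -/
theorem stub_selmerRankCM :
    ∀ (W : WeierstrassCurve ℚ) [W.IsElliptic] [W.IsGloballyMinimal] (p : ℕ) [Fact p.Prime],
      5 ≤ p → W.HasGoodReductionAtPrime p → ¬ (p : ℤ) ∣ W.frobeniusTrace p → W.HasCM →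
        W.selmerCorank p = W.analyticRank := by
  sorry

namespace Statement

/-- Statement of `stub_rankLeOne`. -/
abbrev stub_rankLeOne : Prop := type_of% @Sketch.stub_rankLeOne
/-- Statement of `stub_modular`. -/
abbrev stub_modular : Prop := type_of% @Sketch.stub_modular
/-- Statement of `stub_katoBound`. -/
abbrev stub_katoBound : Prop := type_of% @Sketch.stub_katoBound
/-- Statement of `stub_freeOrderMinimalPrime`. -/
abbrev stub_freeOrderMinimalPrime : Prop := type_of% @Sketch.stub_freeOrderMinimalPrime
/-- Statement of `stub_selmerRankLB`. -/
abbrev stub_selmerRankLB : Prop := type_of% @Sketch.stub_selmerRankLB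
/-- Statement of `stub_selmerRankCM`. -/
abbrev stub_selmerRankCM : Prop := type_of% @Sketch.stub_selmerRankCM

end Statement

/-! ### The crux from the stubs (kernel-checked composition, no `sorry`) -/

/-- COMPOSITION (sorry-free): the six stub statements give the crux BY NAME. Cells: `r_an ≤ 1` by stub 1;
CM by stub 6 at a good ordinary prime from `exists_good_ordinary_prime_holds` (proved); non-CM with
`r_an ≥ 2` at the free prime of stub 4, where `corank_p ≤ ord_T L_p ≤ r_an` (stubs 3, 4, a newform from
stub 2) and `r_an ≤ corank_p` (stub 5). [folklore] -/
theorem PGSelmerBSD_of (h1 : Statement.stub_rankLeOne) (h2 : Statement.stub_modular)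
    (h3 : Statement.stub_katoBound) (h4 : Statement.stub_freeOrderMinimalPrime)
    (h5 : Statement.stub_selmerRankLB) (h6 : Statement.stub_selmerRankCM) :
    Summit.BirchSwinnertonDyer.BirchSwinnertonDyer.Theses.VerticalContact.PGSelmerBSD := by
  intro W _ _ hsec
  by_cases hr : W.analyticRank ≤ 1
  · exact h1 W hr
  by_cases hCM : W.HasCM
  · obtain ⟨p, hp, h5p, hgood, hord⟩ := WeierstrassCurve.exists_good_ordinary_prime_holds W
    exact ⟨p, hp, h6 W p h5p hgood hord hCM⟩
  · obtain ⟨p, hp, ⟨h5p, hgood, hord, hsurj⟩, hC⟩ := h4 W hsec hCM (by omega)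
    obtain ⟨N, hN, f, hf⟩ := h2 W
    have hub : (W.selmerCorank p : ℕ∞) ≤ (W.analyticRank : ℕ∞) :=
      (h3 W p h5p hgood hord hsurj (by omega) f hf).trans (hC f hf)
    exact ⟨p, hp, le_antisymm (by exact_mod_cast hub) (h5 W p h5p hgood hord hsurj)⟩

/-- The crux along this line, MODULO exactly the six registered stubs (depends on `sorryAx` only
through `stub_*`). [folklore] -/
theorem PGSelmerBSD_proof :
    Summit.BirchSwinnertonDyer.BirchSwinnertonDyer.Theses.VerticalContact.PGSelmerBSD :=
  PGSelmerBSD_of stub_rankLeOne stub_modular stub_katoBound stub_freeOrderMinimalPrime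
    stub_selmerRankLB stub_selmerRankCM

/-! ### Proved identifications: stubs 5 and 6 ARE existing items (no new work at this node) -/

/-- Stub 5 is this route's item `SelmerRankLB` (stmt-0131), the same term. [folklore] -/
theorem stub_selmerRankLB_iff :
    Statement.stub_selmerRankLB ↔ VerticalContact.SelmerRankLB := Iff.rfl

/-- … and route SelmerRank's `SelmerRankLB` is the same term. [folklore] -/
theorem stub_selmerRankLB_iff_selmerRank :
    Statement.stub_selmerRankLB ↔ SelmerRank.SelmerRankLB := Iff.rfl

/-- Stub 6 is route SelmerRank's item `SelmerRankCM` (stmt-18086), the same term. [folklore] -/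
theorem stub_selmerRankCM_iff :
    Statement.stub_selmerRankCM ↔ SelmerRank.SelmerRankCM := Iff.rfl

end Summit.BirchSwinnertonDyer.BirchSwinnertonDyer.Cruxes.PGSelmerBSD.Sketch
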